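import Mathlib.RingTheory.PowerSeries.WeierstrassPreparation
import Mathlib.RingTheory.PowerSeries.Substitution
import Mathlib.RingTheory.PowerSeries.Trunc
import Mathlib.RingTheory.PowerSeries.Ideal
import Mathlib.RingTheory.IntegralClosure.IntegrallyClosed
import Mathlib.RingTheory.Localization.FractionRing
import Mathlib.NumberTheory.Padics.RingHoms
import Literature.NumberTheory.GaloisRepresentations.PotentialDiagonalizabilityCriteriaProofs
import HarnessLib

/-!
# A root in `L⟦q⟧` of a Weierstrass-prepared series over `O⟦q⟧` that is a quotient of two
# elements of `O⟦q⟧` lies in `O⟦q⟧` (proofs only)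

Topic `RingTheory/PowerSeries` (theorems only: no definition, no named fact). The local lemma
behind the finite-height refinement recorded in
`Literature/NumberTheory/EllipticCurves/NeronIsogenyScaling.lean` (status block of
`edixhoven_int_of_neronLattice_eq_smul_periodLattice`): let `O` be a complete local principal
ideal domain (e.g. `ℤ_[p]`), `L` a field containing `O`, `A = O⟦q⟧`, and `z ∈ qL⟦q⟧` a series
which is a QUOTIENT of two elements of `A` (`z · Q = P`, `P, Q ∈ A`, `Q ≠ 0`) and on which a power
series `g ∈ O⟦X⟧` with a unit coefficient takes a value in `A` (`g(z) = w ∈ A`, substitution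
`q`-adically). Then `z ∈ A` (`exists_map_eq_of_subst_eq_map`). With `g = [pᵐ]_F` for a formal
group law `F` of finite height this is the integrality statement used there.

Proof: `S(X) = g(X) − w ∈ A⟦X⟧` has nonzero reduction modulo the maximal ideal `(ϖ, q)` of the
complete local ring `A` (`powerSeries_isAdicComplete_maximalIdeal`), so the Weierstrass
preparation theorem (Mathlib's `PowerSeries.exists_isWeierstrassFactorization`) writes
`S = f · h` with `f ∈ A[X]` monic and `h` a unit; evaluating at `z` modulo `qᴺ` for every `N`
(`truncEval`-congruences below: the truncated evaluation `Σ_{i<N} ι(aᵢ) zⁱ` is multiplicative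
modulo `qᴺ` because `q ∣ z`) gives `f(z) = 0`, so `z` is integral over `A`; and `A = O⟦q⟧` is
factorial (Mathlib, `RingTheory/PowerSeries/Ideal`), hence integrally closed, and `z` lies in its
fraction field.

## References

* N. Bourbaki, *Algèbre commutative*, Ch. VII §3 no. 8 (Weierstrass preparation). [folklore]
* The use: T. Honda, *On the theory of commutative formal groups*, J. Math. Soc. Japan 22 (1970),
  Thm. 2 and §6.2 (finite-height formal groups over `ℤ_p`). [Honda1970]
-/

noncomputable section

open scoped Polynomial
open Finset

namespace Literature.RingTheory.PowerSeries

open _root_.PowerSeries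

/-! ### Truncated evaluation of a power series at an element divisible by `t`, modulo `tᴺ` -/

section TruncEval

variable {A T : Type*} [CommRing A] [CommRing T] (ι : A →+* T) (z t : T)

/-- Each term `ι(u_i) zⁱ` with `i ≥ N` is divisible by `tᴺ` when `t ∣ z`. [folklore] -/
theorem pow_dvd_mul_pow_of_le (hz : t ∣ z) {N i : ℕ} (hi : N ≤ i) (a : T) :
    t ^ N ∣ a * z ^ i :=
  (pow_dvd_pow_of_dvd hz N).trans ((pow_dvd_pow z hi).trans (dvd_mul_left _ _))

/-- **Polynomial evaluation modulo `tᴺ` only sees the truncation**: for `u ∈ A[X]` and `t ∣ z`,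
`tᴺ ∣ u(z) − (trunc N u)(z)`. [folklore] -/
theorem pow_dvd_eval₂_sub_eval₂_trunc (hz : t ∣ z) (N : ℕ) (u : A[X]) :
    t ^ N ∣ u.eval₂ ι z - (trunc N (u : A⟦X⟧)).eval₂ ι z := by
  set n := max N (u.natDegree + 1) with hn
  have hNn : N ≤ n := le_max_left _ _
  rw [Polynomial.eval₂_eq_sum_range' ι (show u.natDegree < n by omega) z,
    eval₂_trunc_eq_sum_range, ← sum_range_add_sum_Ico _ hNn]
  have h1 : ∑ i ∈ range N, ι (coeff i (u : A⟦X⟧)) * z ^ i =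
      ∑ i ∈ range N, ι (u.coeff i) * z ^ i :=
    sum_congr rfl fun i _ ↦ by rw [Polynomial.coeff_coe]
  rw [h1, add_sub_cancel_left]
  exact dvd_sum fun i hi ↦ pow_dvd_mul_pow_of_le z t hz (mem_Ico.mp hi).1 _

/-- **Truncated evaluation is multiplicative modulo `tᴺ`**: with
`ev_N(F) = (trunc N F)(z) = Σ_{i<N} ι(Fᵢ) zⁱ` and `t ∣ z`,
`tᴺ ∣ ev_N(F·G) − ev_N(F)·ev_N(G)`. [folklore] -/
theorem pow_dvd_eval₂_trunc_mul_sub (hz : t ∣ z) (N : ℕ) (F G : A⟦X⟧) :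
    t ^ N ∣ (trunc N (F * G)).eval₂ ι z - (trunc N F).eval₂ ι z * (trunc N G).eval₂ ι z := by
  rw [← trunc_trunc_mul_trunc, ← Polynomial.coe_mul, ← Polynomial.eval₂_mul]
  have := pow_dvd_eval₂_sub_eval₂_trunc ι z t hz N (trunc N F * trunc N G)
  rwa [← dvd_neg, neg_sub] at this

/-- Truncated evaluation of a constant (in `X`) series. [folklore] -/
theorem eval₂_trunc_C {N : ℕ} (hN : 0 < N) (a : A) :
    (trunc N (C a : A⟦X⟧)).eval₂ ι z = ι a := by
  obtain ⟨n, rfl⟩ := Nat.exists_eq_succ_of_ne_zero hN.ne'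
  rw [trunc_C, Polynomial.eval₂_C]

/-- The truncated evaluation of a series `h` differs from `ι(h₀)`, `h₀` its constant coefficient,
by a multiple of `z` (so it is a unit as soon as `ι(h₀)` is a unit modulo `z`). [folklore] -/
theorem dvd_eval₂_trunc_sub_constantCoeff (N : ℕ) (h : A⟦X⟧) (hN : 0 < N) :
    z ∣ (trunc N h).eval₂ ι z - ι (constantCoeff h) := by
  rw [eval₂_trunc_eq_sum_range]
  obtain ⟨n, rfl⟩ := Nat.exists_eq_succ_of_ne_zero hN.ne'
  rw [sum_range_succ', pow_zero, mul_one, coeff_zero_eq_constantCoeff_apply, add_sub_cancel_right]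
  exact dvd_sum fun i _ ↦ (dvd_pow_self z i.succ_ne_zero).trans (dvd_mul_left _ _)

end TruncEval

/-! ### `q`-adic substitution versus truncated evaluation -/

section Subst

variable {O L : Type*} [CommRing O] [CommRing L] [Algebra O L]

/-- A power of a series without constant term has no low coefficients. [folklore] -/
theorem coeff_pow_eq_zero_of_lt {z : L⟦X⟧} (hz : constantCoeff z = 0) {m d : ℕ} (hmd : m < d) :
    coeff m (z ^ d) = 0 :=
  X_pow_dvd_iff.mp (pow_dvd_pow_of_dvd (X_dvd_iff.mpr hz) d) m hmd

/-- **The `q`-adic substitution `g(z)` agrees with the truncated evaluation modulo `qᴺ`**: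
for `g ∈ O⟦X⟧` and `z ∈ qL⟦q⟧`,
`qᴺ ∣ g(z) − Σ_{i<N} g_i zⁱ`. [folklore] -/
theorem X_pow_dvd_subst_sub_sum {z : L⟦X⟧} (hz : constantCoeff z = 0) (g : O⟦X⟧) (N : ℕ) :
    (X : L⟦X⟧) ^ N ∣ g.subst z - ∑ i ∈ range N, C (algebraMap O L (coeff i g)) * z ^ i := by
  refine X_pow_dvd_iff.mpr fun m hm ↦ ?_
  rw [map_sub, coeff_subst' (HasSubst.of_constantCoeff_zero' hz), map_sum,
    finsum_eq_sum_of_support_subset _ (s := range N)]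
  · rw [sub_eq_zero]
    refine sum_congr rfl fun i _ ↦ ?_
    rw [coeff_C_mul, Algebra.smul_def]
  · intro d hd
    rw [Function.mem_support] at hd
    by_contra hdN
    apply hd
    rw [coe_range, Set.mem_Iio, not_lt] at hdN
    rw [coeff_pow_eq_zero_of_lt hz (lt_of_lt_of_le hm hdN), smul_zero]

end Subst

/-! ### The monic relation from Weierstrass preparation over `O⟦q⟧` -/

section Preparation

open IsLocalRing

variable {O L : Type*} [CommRing O] [IsLocalRing O] [IsAdicComplete (maximalIdeal O) O]
  [CommRing L] [Algebra O L]

/-- A series all of whose `X`-power multiples divide it vanishes. [folklore] -/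
theorem eq_zero_of_forall_X_pow_dvd {φ : L⟦X⟧} (h : ∀ N : ℕ, (X : L⟦X⟧) ^ N ∣ φ) : φ = 0 := by
  ext m
  rw [map_zero]
  exact X_pow_dvd_iff.mp (h (m + 1)) m m.lt_succ_self

/-- **Weierstrass preparation gives a monic relation.** Let `O` be a complete local ring, `L` an
`O`-algebra, `g ∈ O⟦X⟧` with a unit coefficient in positive degree, `z ∈ qL⟦q⟧`, and suppose the
`q`-adic substitution `g(z)` is the image of some `w ∈ O⟦q⟧`. Then `z` is a root of a MONIC
polynomial with coefficients in `O⟦q⟧`: the distinguished factor of `g − w ∈ O⟦q⟧⟦X⟧`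
(Weierstrass preparation over the complete local ring `O⟦q⟧`, evaluated at `z` modulo every
`qᴺ`). [folklore] -/
theorem exists_monic_eval₂_map_eq_zero {g : O⟦X⟧} {n : ℕ} (hn : 0 < n) (hu : IsUnit (coeff n g))
    {z : L⟦X⟧} (hz : constantCoeff z = 0) {w : O⟦X⟧}
    (hw : g.subst z = w.map (algebraMap O L)) :
    ∃ f : (O⟦X⟧)[X], f.Monic ∧ f.eval₂ (PowerSeries.map (algebraMap O L)) z = 0 := by
  haveI : IsAdicComplete (maximalIdeal O⟦X⟧) O⟦X⟧ :=
    Literature.NumberTheory.GaloisRepresentations.powerSeries_isAdicComplete_maximalIdeal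
  -- the series `S = g − w` over `A = O⟦q⟧` and its nonzero reduction
  set ι : O⟦X⟧ →+* L⟦X⟧ := PowerSeries.map (algebraMap O L) with hι
  set G : (O⟦X⟧)⟦X⟧ := PowerSeries.map (C (R := O)) g with hG
  set S : (O⟦X⟧)⟦X⟧ := G - C w with hS
  have hSn : coeff n S = C (coeff n g) := by
    rw [hS, map_sub, hG, coeff_map, coeff_C, if_neg hn.ne', sub_zero]
  have hS0 : S.map (residue O⟦X⟧) ≠ 0 := by
    intro h0
    have h1 : residue O⟦X⟧ (coeff n S) = 0 := by rw [← coeff_map, h0, map_zero]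
    rw [residue_eq_zero_iff, hSn] at h1
    exact (mem_maximalIdeal _).mp h1 ((hu.map (C (R := O))))
  obtain ⟨f, h, H⟩ := S.exists_isWeierstrassFactorization hS0
  refine ⟨f, H.isDistinguishedAt.monic, eq_zero_of_forall_X_pow_dvd fun N ↦ ?_⟩
  rcases Nat.eq_zero_or_pos N with rfl | hN
  · rw [pow_zero]; exact one_dvd _
  have hXz : (X : L⟦X⟧) ∣ z := X_dvd_iff.mpr hz
  -- truncated evaluation of `S` is divisible by `qᴺ`
  have hevG : (trunc N G).eval₂ ι z = ∑ i ∈ range N, C (algebraMap O L (coeff i g)) * z ^ i := by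
    rw [eval₂_trunc_eq_sum_range]
    refine sum_congr rfl fun i _ ↦ ?_
    rw [hG, coeff_map, hι, map_C]
  have h1 : (X : L⟦X⟧) ^ N ∣ (trunc N S).eval₂ ι z := by
    have := X_pow_dvd_subst_sub_sum hz g N
    rw [hw, ← hevG] at this
    rw [hS, trunc_sub, Polynomial.eval₂_sub, eval₂_trunc_C ι z hN, ← dvd_neg, neg_sub]
    exact this
  -- hence so is that of `f`, the unit `h` being invertible modulo `qᴺ`
  have h2 := pow_dvd_eval₂_trunc_mul_sub ι z X hXz N (f : (O⟦X⟧)⟦X⟧) h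
  rw [← H.eq_mul] at h2
  have h3 : (X : L⟦X⟧) ^ N ∣ (trunc N (f : (O⟦X⟧)⟦X⟧)).eval₂ ι z * (trunc N h).eval₂ ι z := by
    have := (dvd_sub h1 h2); rwa [sub_sub_cancel] at this
  have hunit : IsUnit ((trunc N h).eval₂ ι z) := by
    rw [isUnit_iff_constantCoeff]
    have hd := dvd_eval₂_trunc_sub_constantCoeff ι z N h hN
    have hc : constantCoeff ((trunc N h).eval₂ ι z) = constantCoeff (ι (constantCoeff h)) := by
      obtain ⟨c, hc⟩ := hXz.trans hd
      have := congrArg constantCoeff hc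
      rw [map_sub, map_mul, constantCoeff_X, zero_mul, sub_eq_zero] at this
      exact this
    rw [hc, hι, ← coeff_zero_eq_constantCoeff_apply, coeff_map, coeff_zero_eq_constantCoeff_apply]
    exact ((isUnit_iff_constantCoeff.mp H.isUnit) |> isUnit_iff_constantCoeff.mp).map _
  rw [hunit.dvd_mul_right] at h3
  have h4 := pow_dvd_eval₂_sub_eval₂_trunc ι z X hXz N f
  have := dvd_add h4 h3
  rwa [sub_add_cancel] at this

end Preparation

/-! ### Integrality: a quotient of elements of `O⟦q⟧` which is a root of a monic polynomial -/

section Integral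

variable {O L : Type*} [CommRing O] [IsDomain O] [IsPrincipalIdealRing O] [Field L] [Algebra O L]

/-- **A root in `L⟦q⟧` of a monic polynomial over `O⟦q⟧` that is a quotient of two elements of
`O⟦q⟧` lies in `O⟦q⟧`** (`O` a principal ideal domain embedded in the field `L`): `O⟦q⟧` is
factorial (Mathlib), hence integrally closed. [folklore] -/
theorem exists_map_eq_of_monic_eval₂_eq_zero (hinj : Function.Injective (algebraMap O L))
    {z : L⟦X⟧} {P Q : O⟦X⟧} (hQ : Q ≠ 0)
    (hPQ : z * Q.map (algebraMap O L) = P.map (algebraMap O L))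
    {f : (O⟦X⟧)[X]} (hf : f.Monic) (hfz : f.eval₂ (PowerSeries.map (algebraMap O L)) z = 0) :
    ∃ z₀ : O⟦X⟧, z₀.map (algebraMap O L) = z := by
  classical
  set ι : O⟦X⟧ →+* L⟦X⟧ := PowerSeries.map (algebraMap O L) with hι
  have hιinj : Function.Injective ι := map_injective _ hinj
  set K := FractionRing O⟦X⟧
  set K' := FractionRing L⟦X⟧
  set j : L⟦X⟧ →+* K' := algebraMap L⟦X⟧ K' with hj
  have hjinj : Function.Injective j := IsFractionRing.injective L⟦X⟧ K'
  have hjι : Function.Injective (j.comp ι) := hjinj.comp hιinj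
  set ψ : K →+* K' := IsFractionRing.lift hjι with hψ
  have hψa : ∀ a : O⟦X⟧, ψ (algebraMap O⟦X⟧ K a) = j (ι a) := fun a ↦ by
    rw [hψ, IsFractionRing.lift_algebraMap]; rfl
  set x : K := algebraMap O⟦X⟧ K P / algebraMap O⟦X⟧ K Q with hx
  have hιQ : j (ι Q) ≠ 0 := fun h0 ↦ hQ (hjι (by rw [RingHom.comp_apply, h0, map_zero]))
  have hψx : ψ x = j z := by
    rw [hx, map_div₀, hψa, hψa, div_eq_iff hιQ, ← map_mul, hPQ]
  have hcomp : ψ.comp (algebraMap O⟦X⟧ K) = j.comp ι := RingHom.ext hψa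
  have hint : IsIntegral O⟦X⟧ x := by
    refine ⟨f, hf, ?_⟩
    apply ψ.injective
    rw [Polynomial.hom_eval₂, map_zero, hψx, hcomp, ← Polynomial.hom_eval₂, hfz, map_zero]
  obtain ⟨y, hy⟩ := IsIntegrallyClosed.algebraMap_eq_of_integral hint
  refine ⟨y, hjinj ?_⟩
  rw [← hψx, ← hy, hψa]

end Integral

/-! ### The local lemma -/

section Main

open IsLocalRing

variable {O L : Type*} [CommRing O] [IsDomain O] [IsPrincipalIdealRing O] [IsLocalRing O]
  [IsAdicComplete (maximalIdeal O) O] [Field L] [Algebra O L]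

/-- **The local lemma.** Let `O` be a complete local principal ideal domain embedded in a field
`L`, `g ∈ O⟦X⟧` a series with a unit coefficient in some positive degree (e.g. `[pᵐ]_F` for a
formal group law `F` over `ℤ_p` of finite height), and `z ∈ qL⟦q⟧` a series such that
(i) the `q`-adic substitution `g(z)` lies in (the image of) `O⟦q⟧`, and (ii) `z` is a quotient of
two elements of `O⟦q⟧` (`z · Q = P`, `Q ≠ 0`). Then `z ∈ O⟦q⟧`. (At "infinite height", i.e.
without a unit coefficient in positive degree, this fails: `g = pX`, `z = q/p`.) [folklore] -/
theorem exists_map_eq_of_subst_eq_map (hinj : Function.Injective (algebraMap O L))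
    {g : O⟦X⟧} {n : ℕ} (hn : 0 < n) (hu : IsUnit (coeff n g))
    {z : L⟦X⟧} (hz : constantCoeff z = 0) {w : O⟦X⟧} (hw : g.subst z = w.map (algebraMap O L))
    {P Q : O⟦X⟧} (hQ : Q ≠ 0) (hPQ : z * Q.map (algebraMap O L) = P.map (algebraMap O L)) :
    ∃ z₀ : O⟦X⟧, z₀.map (algebraMap O L) = z := by
  obtain ⟨f, hf, hfz⟩ := exists_monic_eval₂_map_eq_zero hn hu hz hw
  exact exists_map_eq_of_monic_eval₂_eq_zero hinj hQ hPQ hf hfz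

/-- In particular every coefficient of such a `z` lies in `O`; e.g. its linear coefficient (in the
application: the Manin-type scalar `c = [q¹] exp_F(c · ℓ(q))`). [folklore] -/
theorem exists_algebraMap_eq_coeff_of_subst_eq_map (hinj : Function.Injective (algebraMap O L))
    {g : O⟦X⟧} {n : ℕ} (hn : 0 < n) (hu : IsUnit (coeff n g))
    {z : L⟦X⟧} (hz : constantCoeff z = 0) {w : O⟦X⟧} (hw : g.subst z = w.map (algebraMap O L))
    {P Q : O⟦X⟧} (hQ : Q ≠ 0) (hPQ : z * Q.map (algebraMap O L) = P.map (algebraMap O L))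
    (k : ℕ) : ∃ a : O, algebraMap O L a = coeff k z := by
  obtain ⟨z₀, rfl⟩ := exists_map_eq_of_subst_eq_map hinj hn hu hz hw hQ hPQ
  exact ⟨coeff k z₀, (coeff_map _ _ _).symm⟩

/-- **The case `O = ℤ_p`, `L = ℚ_p`** (the instance shape used for formal groups of elliptic
curves over `ℤ_p`). [folklore] -/
theorem padicInt_exists_map_eq_of_subst_eq_map {p : ℕ} [Fact p.Prime]
    {g : ℤ_[p]⟦X⟧} {n : ℕ} (hn : 0 < n) (hu : IsUnit (coeff n g))
    {z : ℚ_[p]⟦X⟧} (hz : constantCoeff z = 0) {w : ℤ_[p]⟦X⟧}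
    (hw : g.subst z = w.map (algebraMap ℤ_[p] ℚ_[p]))
    {P Q : ℤ_[p]⟦X⟧} (hQ : Q ≠ 0)
    (hPQ : z * Q.map (algebraMap ℤ_[p] ℚ_[p]) = P.map (algebraMap ℤ_[p] ℚ_[p])) :
    ∃ z₀ : ℤ_[p]⟦X⟧, z₀.map (algebraMap ℤ_[p] ℚ_[p]) = z :=
  exists_map_eq_of_subst_eq_map (IsFractionRing.injective ℤ_[p] ℚ_[p]) hn hu hz hw hQ hPQ

end Main

end Literature.RingTheory.PowerSeries
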